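import Summits.CriticalPhenomena.PercolationContinuityZ3.Theorems.PercNearOneGluingNoHeavyLowerTailAntitheticContract
import Summits.CriticalPhenomena.PercolationContinuityZ3.Theorems.PercNearOneGluingNoHeavyLowerTailAntitheticLatticePieces
import HarnessLib

/-!
# `NoHeavyLowerTail` (stmt-CriticalPhenomena-4575) — antithetic cluster pairs: DEG-2 ELIMINATION IN VERTEX FORM, part 1 (clusters of
# untied and tied colourings, the tied part, coordinate halving) — prim-hp-2 gen 56, HOME/THEOREM-OneSided.md THEOREM OS⊕-A/B

Support file (`--supports stmt-CriticalPhenomena-4575`, hull-port prover `prim-hp-2`, gen 56).  No definitions, no named facts, no sorries;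
standard axioms.  VERTEX version (monotone functions of the vertex clusters `openCluster`).

SETTING as in …AntitheticContract: `x ≠ s` meets exactly the pairs `e = xy`, `f = xz` of `E` (`y ≠ z`), `g = yz ∉ E`; `E' = E ∖ {e, f}` (the
graph `G − x`), `E'' = E' ∪ {g}` (the contracted edge set); `X_A(ω) = openCluster (ω ∩ A) s`, `Y_A(ω) = openCluster (ωᶜ ∩ A) s`;
`D({x}) = {ω : x ∉ X_E(ω) ∩ Y_E(ω)}`; `Δ(ω) = (F(X_E ω) − F(Y_E ω))(G(X_E ω) − G(Y_E ω))` for monotone `F, G : Set V → ℝ`.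

* `DegTwo.red_untied` / `DegTwo.blue_untied` — for `e` red and `f` blue, `X_E(ω) = X_{E'}(ω) ∪ {x : y ∈ X_{E'}(ω)}` and
  `Y_E(ω) = Y_{E'}(ω) ∪ {x : z ∈ Y_{E'}(ω)}` (pendant-pair reachability of …AntitheticPendant);
* `DegTwo.tied_sum_nonneg` — the TIED part `Σ_{e ≡ f} Δ ≥ 0`: by `Contract.reach_swap(_x)` the clusters of a tied colouring are the
  `x`-expanded clusters of the contracted edge set, an equivariant monotone image of the lattice family `{g ≡ f}`, so the piece lemma
  `piece_latticeFamily` (Harris) applies — no constraint is needed (a tied `x` is joined to `s` in at most one colour);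
* `DegTwo.sum_toggle` — a sum over a toggle-closed set of colourings of a quantity blind to the coordinate `p` is twice the sum over `{p ∈ ω}`;
* (part 2, …AntitheticDegTwoVertex) **`DegTwo.deg2_vertex_reduction`** (THEOREM OS⊕-B): writing
  `TI  = Σ_{ω : y ∉ X_{E'}(ω)} (F(X_{E'} ω) − F(Y_{E'} ω ∪ {x}·[z ∈ Y_{E'} ω]))(G(…) − G(…))` and
  `TII = Σ_{ω : y ∈ X_{E'}(ω), z ∉ Y_{E'}(ω)} (F(X_{E'} ω ∪ {x}) − F(Y_{E'} ω))(G(…) − G(…))` (sums over all `ω ⊆ Sym2 V`),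
  `Σ_{D({x})} Δ = [tied part ≥ 0] + ½·TI + ½·TII`; hence **`0 ≤ TI → 0 ≤ TII → 0 ≤ Σ_{D({x})} Δ`**.  `TI ≥ 0` on every graph is
  `Antithetic.termOne_nonneg` (…AntitheticTermOne, with `A = {x}`), so CONJECTURE Δ2 / vertex-BIC at a degree-2 vertex is reduced to the single
  ONE-SIDED inequality `TII ≥ 0` (certified for FAT8 and all known SHT-less instances, HOME/MEMO-gen56.md §2).
[cite: VandenbergHaggstromKahn2005, §1 p. 6 ("Harris' inequality"), §1 p. 3 (open cluster `C_s`)]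
-/

noncomputable section

namespace Summit.CriticalPhenomena.PercolationContinuityZ3.Theorems

open Literature.Probability.Percolation
open scoped Classical symmDiff

namespace Antithetic

namespace DegTwo

variable {V : Type*}

/-- Toggling a coordinate outside `A` does not change the colouring of `A`. [folklore] -/
theorem symmDiff_singleton_inter {A : Set (Sym2 V)} {p : Sym2 V} (hp : p ∉ A) (ω : Set (Sym2 V)) : (ω ∆ {p}) ∩ A = ω ∩ A := by
  ext q
  simp only [Set.mem_inter_iff, Set.mem_symmDiff, Set.mem_singleton_iff]
  constructor
  · rintro ⟨h | h, hq⟩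
    exacts [⟨h.1, hq⟩, absurd hq (h.1 ▸ hp)]
  · exact fun ⟨h, hq⟩ => ⟨Or.inl ⟨h, fun h' => hp (h' ▸ hq)⟩, hq⟩

/-- Toggling a coordinate outside `A` does not change the complementary colouring of `A`. [folklore] -/
theorem compl_symmDiff_singleton_inter {A : Set (Sym2 V)} {p : Sym2 V} (hp : p ∉ A) (ω : Set (Sym2 V)) :
    (ω ∆ {p})ᶜ ∩ A = ωᶜ ∩ A := by
  ext q
  simp only [Set.mem_inter_iff, Set.mem_compl_iff, Set.mem_symmDiff, Set.mem_singleton_iff, not_or, not_and, not_not]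
  exact ⟨fun ⟨⟨h1, _⟩, hq⟩ => ⟨fun h => hp ((h1 h) ▸ hq), hq⟩,
    fun ⟨h, hq⟩ => ⟨⟨fun h' => absurd h' h, fun h' => absurd hq (h' ▸ hp)⟩, hq⟩⟩

section Toggle

/-- **Coordinate halving.**  If a finite set of colourings is closed under toggling the coordinate `p` and the summand is blind to `p`,
the sum is twice the sum over the members containing `p`. [folklore] -/
theorem sum_toggle (p : Sym2 V) (S : Finset (Set (Sym2 V))) (φ : Set (Sym2 V) → ℝ)
    (hS : ∀ ω, ω ∆ {p} ∈ S ↔ ω ∈ S) (hφ : ∀ ω, φ (ω ∆ {p}) = φ ω) :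
    ∑ ω ∈ S, φ ω = 2 * ∑ ω ∈ S.filter (fun ω => p ∈ ω), φ ω := by
  rw [← Finset.sum_filter_add_sum_filter_not S (fun ω => p ∈ ω)]
  have h : ∑ ω ∈ S.filter (fun ω => p ∉ ω), φ ω = ∑ ω ∈ S.filter (fun ω => p ∈ ω), φ ω := by
    refine Finset.sum_nbij' (fun ω => ω ∆ {p}) (fun ω => ω ∆ {p}) ?_ ?_ ?_ ?_ ?_
    · intro ω hω
      obtain ⟨h1, h2⟩ := Finset.mem_filter.1 hω
      refine Finset.mem_filter.2 ⟨(hS ω).2 h1, ?_⟩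
      rw [Set.mem_symmDiff]; exact Or.inr ⟨rfl, h2⟩
    · intro ω hω
      obtain ⟨h1, h2⟩ := Finset.mem_filter.1 hω
      refine Finset.mem_filter.2 ⟨(hS ω).2 h1, ?_⟩
      rw [Set.mem_symmDiff, not_or]; exact ⟨fun h => h.2 rfl, fun h => h.2 h2⟩
    · intro ω _; exact symmDiff_symmDiff_cancel_right _ _
    · intro ω _; exact symmDiff_symmDiff_cancel_right _ _
    · intro ω _; exact (hφ ω).symm
  rw [h]; ring

/-- Coordinate halving, complementary half. [folklore] -/
theorem sum_toggle_not (p : Sym2 V) (S : Finset (Set (Sym2 V))) (φ : Set (Sym2 V) → ℝ)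
    (hS : ∀ ω, ω ∆ {p} ∈ S ↔ ω ∈ S) (hφ : ∀ ω, φ (ω ∆ {p}) = φ ω) :
    ∑ ω ∈ S, φ ω = 2 * ∑ ω ∈ S.filter (fun ω => p ∉ ω), φ ω := by
  rw [← Finset.sum_filter_add_sum_filter_not S (fun ω => p ∈ ω)]
  have h : ∑ ω ∈ S.filter (fun ω => p ∈ ω), φ ω = ∑ ω ∈ S.filter (fun ω => p ∉ ω), φ ω := by
    refine Finset.sum_nbij' (fun ω => ω ∆ {p}) (fun ω => ω ∆ {p}) ?_ ?_ ?_ ?_ ?_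
    · intro ω hω
      obtain ⟨h1, h2⟩ := Finset.mem_filter.1 hω
      refine Finset.mem_filter.2 ⟨(hS ω).2 h1, ?_⟩
      rw [Set.mem_symmDiff, not_or]; exact ⟨fun h => h.2 rfl, fun h => h.2 h2⟩
    · intro ω hω
      obtain ⟨h1, h2⟩ := Finset.mem_filter.1 hω
      refine Finset.mem_filter.2 ⟨(hS ω).2 h1, ?_⟩
      rw [Set.mem_symmDiff]; exact Or.inr ⟨rfl, h2⟩
    · intro ω _; exact symmDiff_symmDiff_cancel_right _ _
    · intro ω _; exact symmDiff_symmDiff_cancel_right _ _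
    · intro ω _; exact (hφ ω).symm
  rw [h]; ring

end Toggle

section Graph

variable {E : Set (Sym2 V)} {s x y z : V} (hxs : x ≠ s) (hxy : x ≠ y) (hxz : x ≠ z) (hyz : y ≠ z)
  (he : s(x, y) ∈ E) (hf : s(x, z) ∈ E) (hdeg : ∀ h ∈ E, x ∈ h → h = s(x, y) ∨ h = s(x, z)) (hg : s(y, z) ∉ E)

include hdeg in
/-- `x` meets no pair of `E' = E ∖ {e, f}` (it is isolated there). -/
theorem x_isolated : ∀ h ∈ (E \ {s(x, y), s(x, z)}), x ∈ h → h.IsDiag := by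
  intro h hh hx
  obtain ⟨hE, hne⟩ := hh
  rcases hdeg h hE hx with rfl | rfl
  · exact absurd (Or.inl rfl) hne
  · exact absurd (Or.inr rfl) hne

/-- For `e ∈ ω`, `f ∉ ω`: the red edges of `E` are the red edges of `E'` plus `e`. -/
theorem red_eq_insert (ω : Set (Sym2 V)) (he : s(x, y) ∈ E) (h1 : s(x, y) ∈ ω) (h2 : s(x, z) ∉ ω) :
    ω ∩ E = insert s(y, x) (ω ∩ (E \ {s(x, y), s(x, z)})) := by
  ext q
  rw [Sym2.eq_swap (a := y) (b := x)]
  simp only [Set.mem_inter_iff, Set.mem_insert_iff, Set.mem_sdiff, Set.mem_singleton_iff, not_or]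
  constructor
  · rintro ⟨hq, hqE⟩
    by_cases hqe : q = s(x, y)
    · exact Or.inl hqe
    · refine Or.inr ⟨hq, hqE, hqe, ?_⟩
      rintro rfl; exact h2 hq
  · rintro (rfl | ⟨hq, hqE, -, -⟩)
    · exact ⟨h1, he⟩
    · exact ⟨hq, hqE⟩

/-- For `e ∈ ω`, `f ∉ ω`: the blue edges of `E` are the blue edges of `E'` plus `f`. -/
theorem blue_eq_insert (ω : Set (Sym2 V)) (hf : s(x, z) ∈ E) (h1 : s(x, y) ∈ ω) (h2 : s(x, z) ∉ ω) :
    ωᶜ ∩ E = insert s(z, x) (ωᶜ ∩ (E \ {s(x, y), s(x, z)})) := by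
  ext q
  rw [Sym2.eq_swap (a := z) (b := x)]
  simp only [Set.mem_inter_iff, Set.mem_compl_iff, Set.mem_insert_iff, Set.mem_sdiff, Set.mem_singleton_iff, not_or]
  constructor
  · rintro ⟨hq, hqE⟩
    by_cases hqf : q = s(x, z)
    · exact Or.inl hqf
    · refine Or.inr ⟨hq, hqE, ?_, hqf⟩
      rintro rfl; exact hq h1
  · rintro (rfl | ⟨hq, hqE, -, -⟩)
    · exact ⟨h2, hf⟩
    · exact ⟨hq, hqE⟩

include hxs hxy he hdeg in
/-- **Untied colourings, red cluster**: for `e` red and `f` blue, `X_E = X_{E'} ∪ {x : y ∈ X_{E'}}`. [this work] -/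
theorem red_untied (ω : Set (Sym2 V)) (h1 : s(x, y) ∈ ω) (h2 : s(x, z) ∉ ω) :
    openCluster (ω ∩ E) s =
      openCluster (ω ∩ (E \ {s(x, y), s(x, z)})) s ∪
        {v | v ∈ ({x} : Set V) ∧ y ∈ openCluster (ω ∩ (E \ {s(x, y), s(x, z)})) s} := by
  set η := ω ∩ (E \ {s(x, y), s(x, z)}) with hη
  have hiso : ∀ h ∈ η, x ∈ h → h.IsDiag := fun h hh hx => x_isolated hdeg h hh.2 hx
  rw [red_eq_insert ω he h1 h2]
  ext v
  simp only [Set.mem_union, Set.mem_setOf_eq, Set.mem_singleton_iff]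
  by_cases hv : v = x
  · subst hv
    rw [show (v ∈ openCluster (insert s(y, v) η) s ↔ (openGraph (insert s(y, v) η)).Reachable s v) from Iff.rfl,
      Pendant.reachable_leaf_iff η y v hiso hxy.symm hxs.symm]
    constructor
    · exact fun h => Or.inr ⟨rfl, h⟩
    · rintro (h | ⟨-, h⟩)
      · exact absurd h (Pendant.not_reachable_leaf η v hiso hxs.symm)
      · exact h
  · rw [show (v ∈ openCluster (insert s(y, x) η) s ↔ (openGraph (insert s(y, x) η)).Reachable s v) from Iff.rfl,
      Pendant.reachable_iff η y x hiso hxy.symm hxs.symm hv]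
    constructor
    · exact fun h => Or.inl h
    · rintro (h | ⟨h, -⟩)
      · exact h
      · exact absurd h hv

include hxs hxz hf hdeg in
/-- **Untied colourings, blue cluster**: for `e` red and `f` blue, `Y_E = Y_{E'} ∪ {x : z ∈ Y_{E'}}`. [this work] -/
theorem blue_untied (ω : Set (Sym2 V)) (h1 : s(x, y) ∈ ω) (h2 : s(x, z) ∉ ω) :
    openCluster (ωᶜ ∩ E) s =
      openCluster (ωᶜ ∩ (E \ {s(x, y), s(x, z)})) s ∪
        {v | v ∈ ({x} : Set V) ∧ z ∈ openCluster (ωᶜ ∩ (E \ {s(x, y), s(x, z)})) s} := by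
  set η := ωᶜ ∩ (E \ {s(x, y), s(x, z)}) with hη
  have hiso : ∀ h ∈ η, x ∈ h → h.IsDiag := fun h hh hx => x_isolated hdeg h hh.2 hx
  rw [blue_eq_insert ω hf h1 h2]
  ext v
  simp only [Set.mem_union, Set.mem_setOf_eq, Set.mem_singleton_iff]
  by_cases hv : v = x
  · subst hv
    rw [show (v ∈ openCluster (insert s(z, v) η) s ↔ (openGraph (insert s(z, v) η)).Reachable s v) from Iff.rfl,
      Pendant.reachable_leaf_iff η z v hiso hxz.symm hxs.symm]
    constructor
    · exact fun h => Or.inr ⟨rfl, h⟩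
    · rintro (h | ⟨-, h⟩)
      · exact absurd h (Pendant.not_reachable_leaf η v hiso hxs.symm)
      · exact h
  · rw [show (v ∈ openCluster (insert s(z, x) η) s ↔ (openGraph (insert s(z, x) η)).Reachable s v) from Iff.rfl,
      Pendant.reachable_iff η z x hiso hxz.symm hxs.symm hv]
    constructor
    · exact fun h => Or.inl h
    · rintro (h | ⟨h, -⟩)
      · exact h
      · exact absurd h hv

include hxs hxy hxz hyz he hf hdeg hg in
/-- **Tied colourings, clusters**: for `ω'` with `g ∈ ω' ↔ f ∈ ω'`, the red cluster of `E` at the swapped colouring `swap ω'` is the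
`x`-expanded red cluster of the contracted edge set `E''` at `ω'`. [this work] -/
theorem red_tied (ω' : Set (Sym2 V)) (hT : s(y, z) ∈ ω' ↔ s(x, z) ∈ ω') :
    openCluster (Contract.swap s(x, y) s(y, z) ω' ∩ E) s =
      openCluster (ω' ∩ insert s(y, z) (E \ {s(x, y), s(x, z)})) s ∪
        {v | v = x ∧ s(y, z) ∈ ω' ∧ (y ∈ openCluster (ω' ∩ insert s(y, z) (E \ {s(x, y), s(x, z)})) s ∨
          z ∈ openCluster (ω' ∩ insert s(y, z) (E \ {s(x, y), s(x, z)})) s)} := by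
  ext v
  simp only [Set.mem_union, Set.mem_setOf_eq]
  by_cases hv : v = x
  · subst hv
    rw [show (v ∈ openCluster (Contract.swap s(v, y) s(y, z) ω' ∩ E) s ↔
        (openGraph (Contract.swap s(v, y) s(y, z) ω' ∩ E)).Reachable s v) from Iff.rfl,
      Contract.reach_swap_x hxs hxy hxz hyz he hf hdeg hg ω' hT]
    constructor
    · exact fun h => Or.inr ⟨rfl, h⟩
    · rintro (h | ⟨-, h⟩)
      · -- `x` is isolated in the contracted edge set
        exact absurd (show (openGraph _).Reachable s v from h) (Contract.not_reach_contracted hxs hxy hxz hdeg ω')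
      · exact h
  · rw [show (v ∈ openCluster (Contract.swap s(x, y) s(y, z) ω' ∩ E) s ↔
        (openGraph (Contract.swap s(x, y) s(y, z) ω' ∩ E)).Reachable s v) from Iff.rfl,
      Contract.reach_swap hxs hxy hxz hyz he hf hdeg hg ω' hT hv]
    constructor
    · exact fun h => Or.inl h
    · rintro (h | ⟨h, -⟩)
      · exact h
      · exact absurd h hv

end Graph

section Sums

variable [Fintype V] {E : Set (Sym2 V)} {s x y z : V} (hxs : x ≠ s) (hxy : x ≠ y) (hxz : x ≠ z) (hyz : y ≠ z)
  (he : s(x, y) ∈ E) (hf : s(x, z) ∈ E) (hdeg : ∀ h ∈ E, x ∈ h → h = s(x, y) ∨ h = s(x, z)) (hg : s(y, z) ∉ E)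
include hxs hxy hxz hyz he hf hdeg hg

/-- **Tied part**: the antithetic sum over the colourings in which the two pairs at `x` have the same colour is nonnegative
(Harris on the lattice family `{g ≡ f}` transported by `swap`; no constraint needed). [this work] -/
theorem tied_sum_nonneg {F G : Set V → ℝ} (hF : Monotone F) (hG : Monotone G) :
    0 ≤ ∑ ω ∈ Finset.univ.filter (fun ω : Set (Sym2 V) => (s(x, y) ∈ ω ↔ s(x, z) ∈ ω)),
      (F (openCluster (ω ∩ E) s) - F (openCluster (ωᶜ ∩ E) s)) *
        (G (openCluster (ω ∩ E) s) - G (openCluster (ωᶜ ∩ E) s)) := by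
  have hge := Contract.g_ne_e (y := y) (z := z) hxy hxz
  have hgf := Contract.g_ne_f (y := y) (z := z) hxy hxz
  have hef := Contract.e_ne_f (x := x) hyz
  set E'' := insert s(y, z) (E \ {s(x, y), s(x, z)}) with hE''
  let XV : Set (Sym2 V) → Set V := fun ω' => openCluster (ω' ∩ E'') s ∪
    {v | v = x ∧ s(y, z) ∈ ω' ∧ (y ∈ openCluster (ω' ∩ E'') s ∨ z ∈ openCluster (ω' ∩ E'') s)}
  have hXV : Monotone XV := by
    intro a b hab v hv
    have hc : openCluster (a ∩ E'') s ⊆ openCluster (b ∩ E'') s := by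
      intro u hu
      refine hu.mono fun p q hpq => ?_
      rw [openGraph_adj] at hpq ⊢
      exact ⟨⟨hab hpq.1.1, hpq.1.2⟩, hpq.2⟩
    rcases hv with hv | ⟨hvx, hgm, hyz'⟩
    · exact Or.inl (hc hv)
    · refine Or.inr ⟨hvx, hab hgm, ?_⟩
      rcases hyz' with h | h
      · exact Or.inl (hc h)
      · exact Or.inr (hc h)
  let Ψ : Set (Sym2 V) → ℝ := fun ω => (F (openCluster (ω ∩ E) s) - F (openCluster (ωᶜ ∩ E) s)) *
    (G (openCluster (ω ∩ E) s) - G (openCluster (ωᶜ ∩ E) s))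
  let 𝒜 : Finset (Set (Sym2 V)) := Finset.univ.filter fun ω' => (s(y, z) ∈ ω' ↔ s(x, z) ∈ ω')
  show 0 ≤ ∑ ω ∈ Finset.univ.filter (fun ω : Set (Sym2 V) => (s(x, y) ∈ ω ↔ s(x, z) ∈ ω)), Ψ ω
  -- reindex by `swap` (exchange the coordinates `g` and `e`)
  have hre : ∑ ω' ∈ 𝒜, Ψ (Contract.swap s(x, y) s(y, z) ω') =
      ∑ ω ∈ Finset.univ.filter (fun ω : Set (Sym2 V) => (s(x, y) ∈ ω ↔ s(x, z) ∈ ω)), Ψ ω := by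
    refine Finset.sum_nbij' (Contract.swap s(x, y) s(y, z)) (Contract.swap s(x, y) s(y, z)) ?_ ?_ ?_ ?_ ?_
    · intro ω' hω'
      have hT := (Finset.mem_filter.1 hω').2
      refine Finset.mem_filter.2 ⟨Finset.mem_univ _, ?_⟩
      rw [Contract.mem_swap_e hge, Contract.mem_swap_other ω' hgf.symm hef.symm]; exact hT
    · intro ω hω
      have hT := (Finset.mem_filter.1 hω).2
      refine Finset.mem_filter.2 ⟨Finset.mem_univ _, ?_⟩
      rw [Contract.mem_swap_g hge, Contract.mem_swap_other ω hgf.symm hef.symm]; exact hT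
    · intro ω' _; exact Contract.swap_swap hge ω'
    · intro ω _; exact Contract.swap_swap hge ω
    · intro ω' _; rfl
  rw [← hre]
  -- clusters of a tied colouring are the expanded contracted clusters
  have hΨ : ∀ ω' ∈ 𝒜, Ψ (Contract.swap s(x, y) s(y, z) ω') = (F (XV ω') - F (XV ω'ᶜ)) * (G (XV ω') - G (XV ω'ᶜ)) := by
    intro ω' hω'
    have hT : (s(y, z) ∈ ω' ↔ s(x, z) ∈ ω') := (Finset.mem_filter.1 hω').2
    have hTc : (s(y, z) ∈ ω'ᶜ ↔ s(x, z) ∈ ω'ᶜ) := by rw [Set.mem_compl_iff, Set.mem_compl_iff]; exact not_congr hT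
    have h1 : openCluster (Contract.swap s(x, y) s(y, z) ω' ∩ E) s = XV ω' := red_tied hxs hxy hxz hyz he hf hdeg hg ω' hT
    have h2 : openCluster ((Contract.swap s(x, y) s(y, z) ω')ᶜ ∩ E) s = XV ω'ᶜ := by
      rw [Contract.swap_compl hge]; exact red_tied hxs hxy hxz hyz he hf hdeg hg ω'ᶜ hTc
    show (F (openCluster (Contract.swap s(x, y) s(y, z) ω' ∩ E) s) - F (openCluster ((Contract.swap s(x, y) s(y, z) ω')ᶜ ∩ E) s)) *
      (G (openCluster (Contract.swap s(x, y) s(y, z) ω' ∩ E) s) - G (openCluster ((Contract.swap s(x, y) s(y, z) ω')ᶜ ∩ E) s)) = _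
    rw [h1, h2]
  rw [Finset.sum_congr rfl hΨ]
  -- the piece lemma on the lattice family `{g ≡ f}`
  have hinf : ∀ a ∈ 𝒜, ∀ b ∈ 𝒜, a ⊓ b ∈ 𝒜 := by
    intro a ha b hb
    have ha' := (Finset.mem_filter.1 ha).2; have hb' := (Finset.mem_filter.1 hb).2
    refine Finset.mem_filter.2 ⟨Finset.mem_univ _, ?_⟩
    show s(y, z) ∈ a ∩ b ↔ s(x, z) ∈ a ∩ b
    rw [Set.mem_inter_iff, Set.mem_inter_iff, ha', hb']
  have hsup : ∀ a ∈ 𝒜, ∀ b ∈ 𝒜, a ⊔ b ∈ 𝒜 := by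
    intro a ha b hb
    have ha' := (Finset.mem_filter.1 ha).2; have hb' := (Finset.mem_filter.1 hb).2
    refine Finset.mem_filter.2 ⟨Finset.mem_univ _, ?_⟩
    show s(y, z) ∈ a ∪ b ↔ s(x, z) ∈ a ∪ b
    rw [Set.mem_union, Set.mem_union, ha', hb']
  have hcompl : ∀ a ∈ 𝒜, aᶜ ∈ 𝒜 := by
    intro a ha
    have ha' := (Finset.mem_filter.1 ha).2
    refine Finset.mem_filter.2 ⟨Finset.mem_univ _, ?_⟩
    rw [Set.mem_compl_iff, Set.mem_compl_iff]; exact not_congr ha'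
  have hbot : (⊥ : Set (Sym2 V)) ∈ 𝒜 := Finset.mem_filter.2 ⟨Finset.mem_univ _, by simp⟩
  have hΦ : ∀ a ∈ 𝒜, ∀ b ∈ 𝒜, a ≤ b → XV bᶜ ≤ XV aᶜ := fun a _ b _ hab => hXV (compl_le_compl hab)
  have h := piece_latticeFamily 𝒜 hinf hsup hcompl hbot (fun A => XV Aᶜ) hΦ hF hG
  refine h.trans_eq (Finset.sum_congr rfl fun a _ => ?_)
  simp only [compl_compl]
  ring

omit [Fintype V] hxy hxz hyz he hf hg in
/-- A tied colouring never joins `x` to `s` in both colours (one of the two open graphs has no edge at `x`). [this work] -/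
theorem not_both_of_tied (ω : Set (Sym2 V)) (hT : s(x, y) ∈ ω ↔ s(x, z) ∈ ω) :
    ¬ ((openGraph (ω ∩ E)).Reachable s x ∧ (openGraph (ωᶜ ∩ E)).Reachable s x) := by
  rintro ⟨hr, hb⟩
  by_cases h1 : s(x, y) ∈ ω
  · -- both pairs red: `x` is isolated in the blue graph
    have h2 : s(x, z) ∈ ω := hT.1 h1
    refine Pendant.not_reachable_leaf (ωᶜ ∩ E) x (fun h hh hx => ?_) hxs.symm hb
    rcases hdeg h hh.2 hx with rfl | rfl
    · exact absurd h1 hh.1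
    · exact absurd h2 hh.1
  · have h2 : s(x, z) ∉ ω := fun h => h1 (hT.2 h)
    refine Pendant.not_reachable_leaf (ω ∩ E) x (fun h hh hx => ?_) hxs.symm hr
    rcases hdeg h hh.2 hx with rfl | rfl
    · exact absurd hh.1 h1
    · exact absurd hh.1 h2

end Sums

end DegTwo


end Antithetic

end Summit.CriticalPhenomena.PercolationContinuityZ3.Theorems
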